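import Literature.InformationTheory.QuantumCodes.ConcatenationHierarchicalDecoding
import Literature.InformationTheory.QuantumCodes.DepolarizingCSSDecoding
import HarnessLib

/-!
# Sector-wise hierarchical decoding of a concatenated CSS block under DEPOLARIZING noise: threshold `(3/2)·ε₀`
# (Steane code: `1/14`), double-exponential suppression — code-capacity model

Topic `Literature/InformationTheory/QuantumCodes` (continues `ConcatenationHierarchicalDecoding.lean`; uses the depolarizing marginals
of `DepolarizingCSSDecoding.lean`). A Pauli error `E` on the `n^k` elementary locations has a bit-flip part (`xPattern E`, letters `X, Y`)
and a phase-flip part (`zPattern E`, letters `Y, Z`); a CSS block is decoded SECTOR-WISE, each part by the hierarchical decoder of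
`ConcatenationHierarchicalDecoding.lean` (Dennis–Kitaev–Landahl–Preskill §4.1: "recovery from `X` errors and `Z` errors separately"),
and decoding FAILS iff a logical flip survives in either sector (`DepolFails`). Under i.i.d. depolarizing noise of rate `p` (each of
`X, Y, Z` with probability `p/3`) each part is a pattern of INDEPENDENT flips of rate `2p/3` (`sum_depolarizingProb_xBit_mem`), so:

* `depolFailProb_le_two_mul_flipProb` — `ℙ_depol(fail at level k) ≤ 2 · flipProb dec (2p/3) k` (union bound + the two marginals);
* **`depolFailProb_le_levelBound`** — `≤ 2 ε₀ ((2p/3)/ε₀)^{2^k}`, `ε₀ = (n choose 2)⁻¹`: the depolarizing code-capacity threshold of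
  sector-wise hierarchical decoding is at least `(3/2)·ε₀`;
* **`depolFailProb_steane_le`** — Steane-code blocks (`n = 7`, Hamming-syndrome decoding in both sectors, `steaneSector`):
  for `0 ≤ p ≤ 1/14`, `ℙ_depol(fail at level k) ≤ (2/21)·(14 p)^{2^k}` — **threshold `≥ 1/14 ≈ 7.1 %`** for the concatenated Steane
  family under sector-wise hierarchical decoding in the code-capacity model.

HONEST FRAMING: code-capacity model (noise on the data locations only, flawless syndrome extraction); sector-wise decoding ignores the
`X`/`Z` correlation carried by `Y` (the `3/2` is the exact marginal factor, `DepolarizingCSSDecoding.lean`); these are LOWER bounds on the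
threshold of this explicit decoder, not statements about optimal decoding, and not circuit-level (AGP06 exRec) thresholds.

## References

* [AliferisGottesmanPreskill2006] P. Aliferis, D. Gottesman, J. Preskill, Quantum Inf. Comput. 6 (2006) 97–165, §3.1–3.2 (badness,
  Lemma 2, the recursive decoder), §7 (Steane's [[7,1,3]] code), §8.3 (depolarizing noise, ε/3 per Pauli).
* [DennisEtAl2002] E. Dennis, A. Kitaev, A. Landahl, J. Preskill, J. Math. Phys. 43 (2002) 4452, §4.1 (X and Z errors corrected
  separately; the depolarizing channel).
-/

noncomputable section

open Finset Literature.Computability.QuantumComplexity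
open scoped BigOperators

namespace Literature.InformationTheory.QuantumCodes

namespace AGP06

variable {n : ℕ}

/-! ### Bit patterns as Boolean fault patterns -/

/-- The Boolean fault pattern of an `𝔽₂`-valued pattern (`true` = the bit is `1`). [cite: DennisEtAl2002, §4.1] -/
def ofBits {V : Type*} (x : V → ZMod 2) : V → Bool := fun v => decide (x v ≠ 0)

/-- `ofBits` is a bijection between `𝔽₂`-patterns and Boolean patterns. [cite: DennisEtAl2002, §4.1] -/
def ofBitsEquiv (V : Type*) : (V → ZMod 2) ≃ (V → Bool) where
  toFun := ofBits
  invFun b := fun v => if b v then 1 else 0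
  left_inv x := by
    funext v
    have hx : x v = 0 ∨ x v = 1 := by
      have : ∀ a : ZMod 2, a = 0 ∨ a = 1 := by decide
      exact this (x v)
    rcases hx with h | h <;> simp [ofBits, h]
  right_inv b := by
    funext v
    cases hb : b v <;> simp [ofBits, hb]

/-- The independent weight of the Boolean pattern of `x` is the Bernoulli weight of the support of `x`.
[cite: DennisEtAl2002, §4.4 eq. (prob_E)] -/
theorem wt_ofBits (p : ℝ) (k : ℕ) (x : (Fin k → Fin n) → ZMod 2) :
    wt p k (ofBits x) = bernoulliWeight p (supp x) := by
  rw [← prod_ite_eq_bernoulliWeight]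
  unfold wt ofBits
  refine Finset.prod_congr rfl fun v _ => ?_
  by_cases h : x v = 0 <;> simp [h]

/-- A sum over Boolean patterns is the corresponding sum over `𝔽₂`-patterns. [cite: DennisEtAl2002, §4.1] -/
theorem sum_ofBits {V : Type*} [Fintype V] [DecidableEq V] (f : (V → Bool) → ℝ) :
    ∑ x : V → ZMod 2, f (ofBits x) = ∑ b : V → Bool, f b :=
  Fintype.sum_equiv (ofBitsEquiv V) _ _ fun _ => rfl

/-! ### The two parts of a Pauli error and the sector-wise failure event -/

/-- The bit-flip part of a Pauli error (`true` at the letters `X, Y`). [cite: DennisEtAl2002, §4.1 (X errors)] -/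
def xPattern {V : Type*} (E : V → Pauli) : V → Bool := ofBits fun v => xBit (E v)

/-- The phase-flip part of a Pauli error (`true` at the letters `Y, Z`). [cite: DennisEtAl2002, §4.1 (Z errors)] -/
def zPattern {V : Type*} (E : V → Pauli) : V → Bool := ofBits fun v => zBit (E v)

/-- **Sector-wise hierarchical decoding fails** on the Pauli error `E` iff a logical bit flip OR a logical phase flip survives
(each sector decoded by the recursive decoder `logicalFlip dec`). [cite: DennisEtAl2002, §4.1 (recovery from X errors and Z errors separately)] -/
def DepolFails (dec : (Fin n → Bool) → Bool) (k : ℕ) (E : (Fin k → Fin n) → Pauli) : Prop :=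
  logicalFlip dec k (xPattern E) = true ∨ logicalFlip dec k (zPattern E) = true

/-- The failure event is decidable. [cite: DennisEtAl2002, §4.1] -/
instance instDecidableDepolFails (dec : (Fin n → Bool) → Bool) (k : ℕ) (E : (Fin k → Fin n) → Pauli) :
    Decidable (DepolFails dec k E) := by
  unfold DepolFails; infer_instance

/-- The failure probability of sector-wise hierarchical decoding under i.i.d. depolarizing noise of rate `p`.
[cite: AliferisGottesmanPreskill2006, §8.3 (depolarizing noise)] -/
def depolFailProb (dec : (Fin n → Bool) → Bool) (p : ℝ) (k : ℕ) : ℝ :=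
  ∑ E : (Fin k → Fin n) → Pauli, if DepolFails dec k E then depolarizingProb p E else 0

/-! ### The marginals and the union bound -/

/-- **Bit-flip marginal**: the depolarizing mass of "a logical bit flip survives" is the independent-flip (rate `2p/3`) mass of
"a logical flip survives". [cite: DennisEtAl2002, §4.1 (the depolarizing channel vs. independent bit flips)] -/
theorem sum_depolarizingProb_xFlip (dec : (Fin n → Bool) → Bool) (p : ℝ) (k : ℕ) :
    ∑ E ∈ univ.filter (fun E : (Fin k → Fin n) → Pauli => logicalFlip dec k (xPattern E) = true), depolarizingProb p E =
      flipProb dec (2 * p / 3) k := by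
  classical
  have h := sum_depolarizingProb_xBit_mem (Q := Fin k → Fin n) p
    (univ.filter fun x : (Fin k → Fin n) → ZMod 2 => logicalFlip dec k (ofBits x) = true)
  have hfilter : (univ.filter fun E : (Fin k → Fin n) → Pauli =>
      (fun q => xBit (E q)) ∈ univ.filter (fun x : (Fin k → Fin n) → ZMod 2 => logicalFlip dec k (ofBits x) = true)) =
      univ.filter (fun E : (Fin k → Fin n) → Pauli => logicalFlip dec k (xPattern E) = true) := by
    ext E; simp [xPattern]
  rw [hfilter] at h
  rw [h, Finset.sum_filter]
  unfold flipProb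
  rw [← sum_ofBits]
  refine Finset.sum_congr rfl fun x _ => ?_
  rw [wt_ofBits]

/-- **Phase-flip marginal**, likewise. [cite: DennisEtAl2002, §4.1 (the depolarizing channel vs. independent phase flips)] -/
theorem sum_depolarizingProb_zFlip (dec : (Fin n → Bool) → Bool) (p : ℝ) (k : ℕ) :
    ∑ E ∈ univ.filter (fun E : (Fin k → Fin n) → Pauli => logicalFlip dec k (zPattern E) = true), depolarizingProb p E =
      flipProb dec (2 * p / 3) k := by
  classical
  have h := sum_depolarizingProb_zBit_mem (Q := Fin k → Fin n) p
    (univ.filter fun x : (Fin k → Fin n) → ZMod 2 => logicalFlip dec k (ofBits x) = true)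
  have hfilter : (univ.filter fun E : (Fin k → Fin n) → Pauli =>
      (fun q => zBit (E q)) ∈ univ.filter (fun x : (Fin k → Fin n) → ZMod 2 => logicalFlip dec k (ofBits x) = true)) =
      univ.filter (fun E : (Fin k → Fin n) → Pauli => logicalFlip dec k (zPattern E) = true) := by
    ext E; simp [zPattern]
  rw [hfilter] at h
  rw [h, Finset.sum_filter]
  unfold flipProb
  rw [← sum_ofBits]
  refine Finset.sum_congr rfl fun x _ => ?_
  rw [wt_ofBits]

/-- **Union bound over the two sectors**: `ℙ_depol(fail) ≤ 2 · flipProb dec (2p/3) k` (`0 ≤ p ≤ 1`).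
[cite: DennisEtAl2002, §4.1; AliferisGottesmanPreskill2006, §8.3] -/
theorem depolFailProb_le_two_mul_flipProb (dec : (Fin n → Bool) → Bool) {p : ℝ} (hp0 : 0 ≤ p) (hp1 : p ≤ 1) (k : ℕ) :
    depolFailProb dec p k ≤ 2 * flipProb dec (2 * p / 3) k := by
  classical
  have hw : ∀ E : (Fin k → Fin n) → Pauli, 0 ≤ depolarizingProb p E := fun E => depolarizingProb_nonneg hp0 hp1 E
  unfold depolFailProb
  calc ∑ E : (Fin k → Fin n) → Pauli, (if DepolFails dec k E then depolarizingProb p E else 0)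
      ≤ ∑ E : (Fin k → Fin n) → Pauli,
          ((if logicalFlip dec k (xPattern E) = true then depolarizingProb p E else 0) +
            (if logicalFlip dec k (zPattern E) = true then depolarizingProb p E else 0)) := by
        refine Finset.sum_le_sum fun E _ => ?_
        unfold DepolFails
        by_cases hx : logicalFlip dec k (xPattern E) = true <;> by_cases hz : logicalFlip dec k (zPattern E) = true <;>
          simp [hx, hz, hw E]
    _ = flipProb dec (2 * p / 3) k + flipProb dec (2 * p / 3) k := by
        rw [Finset.sum_add_distrib, ← Finset.sum_filter, ← Finset.sum_filter, sum_depolarizingProb_xFlip,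
          sum_depolarizingProb_zFlip]
    _ = 2 * flipProb dec (2 * p / 3) k := by ring

/-- **Depolarizing threshold `(3/2)·ε₀` of sector-wise hierarchical decoding**: `ℙ_depol(fail at level k) ≤ 2 ε₀ ((2p/3)/ε₀)^{2^k}`,
`ε₀ = (n choose 2)⁻¹`, for every block decoder correcting one flipped sub-block (`n ≥ 2`, `0 ≤ p ≤ 1`).
[cite: AliferisGottesmanPreskill2006, Lemma 2 with §3.2 and §8.3] -/
theorem depolFailProb_le_levelBound {dec : (Fin n → Bool) → Bool} (hdec : CorrectsSingleFlips dec) {p : ℝ} (hp0 : 0 ≤ p)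
    (hp1 : p ≤ 1) (hn : 2 ≤ n) (k : ℕ) :
    depolFailProb dec p k ≤ 2 * levelBound ((n.choose 2 : ℝ)⁻¹) (2 * p / 3) k := by
  have h1 := depolFailProb_le_two_mul_flipProb dec hp0 hp1 k
  have h2 := flipProb_le_levelBound hdec (p := 2 * p / 3) (by linarith) (by linarith) hn k
  linarith

/-- **Threshold `≥ 1/14` for the concatenated Steane family under depolarizing noise** (code-capacity model, sector-wise hierarchical
Hamming-syndrome decoding): for `0 ≤ p ≤ 1/14`, `ℙ_depol(fail at level k) ≤ (2/21)·(14 p)^{2^k}`.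
[cite: AliferisGottesmanPreskill2006, Lemma 2 with §3.2, §7 and §8.3] -/
theorem depolFailProb_steane_le {p : ℝ} (hp0 : 0 ≤ p) (hp : p ≤ 1 / 14) (k : ℕ) :
    depolFailProb steaneSector p k ≤ 2 / 21 * (14 * p) ^ 2 ^ k := by
  have h1 := depolFailProb_le_two_mul_flipProb steaneSector hp0 (by linarith) k
  have h2 := flipProb_steaneSector_le (p := 2 * p / 3) (by linarith) (by linarith) k
  have e : (21 : ℝ) * (2 * p / 3) = 14 * p := by ring
  rw [e] at h2
  linarith

end AGP06

end Literature.InformationTheory.QuantumCodes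

end
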